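import Summits.Ventures.PercRepro.SevenThreeSeriesClasses
import Summits.Ventures.PercRepro.SevenThreeCycCount

/-!
# PercRepro — the `(7,3)` cell: the cyclic sets of a nullity-two restriction through its series classes (p3, gen 16)

For a coloop-free `K` of nullity two (`SevenThreeNullityTwo.lean`) and `C ⊆ K`, write `hitsF K C` for the number of
series classes met by `C`. Then `drk K C = 2` iff `C` meets at least two classes (`drk_eq_two_iff_two_le_hits`), and
`C` is cyclic of dual rank two iff it meets at least three classes or exactly two classes in at least two points each
(`isCyc_and_drk_two_iff`) — the `cycCond` of the star table. Enumerating the classes by a list `L` (no duplicates,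
`L.toFinset = serClasses K`), the table's `cyc (L.map card) s` is exactly the number of cyclic `s`-subsets of `K` of
dual rank two (`cyc_eq_card_filter`): Lemma 27.2's `cyc_j` in the kernel.
(`P3-C025-seven-three-plan.md` §9 (R2).)
-/

namespace PercRepro

namespace SevenThree

open Finset ThmH SixThree CycCount

variable {α : Type*} [DecidableEq α] {M : Matroid α} [M.Finite]

/-- The number of series classes of `K` met by `C`. -/
noncomputable def hitsF (M : Matroid α) [M.Finite] (K C : Finset α) : ℕ :=
  ((serClasses M K).filter (fun N => (C ∩ N).Nonempty)).card

/-- Two points of `C ⊆ K` in different classes are not in series. -/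
theorem not_ser_of_ne_serClass {K : Finset α} (hK : K ⊆ gr M) (hcf : cyclicPart M K = K) {f g : α}
    (hf : f ∈ K) (hg : g ∈ K) (hne : serClass M K f ≠ serClass M K g) : ¬ Ser M K f g := by
  intro h
  exact hne (serClass_eq_of_ser hK (by rw [hcf]; exact hf) (by rw [hcf]; exact hg) h)

/-- `drk K C = 2` iff `C` meets at least two series classes. -/
theorem drk_eq_two_iff_two_le_hits {K C : Finset α} (hK : K ⊆ gr M) (hK2 : nrk M K + 2 = K.card)
    (hcf : cyclicPart M K = K) (hC : C ⊆ K) : drk M K C = 2 ↔ 2 ≤ hitsF M K C := by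
  rw [drk_eq_two_iff hK hK2 hcf hC]
  unfold hitsF
  constructor
  · rintro ⟨e, he, f, hf, hns⟩
    have heK : e ∈ cyclicPart M K := by rw [hcf]; exact hC he
    have hfK : f ∈ cyclicPart M K := by rw [hcf]; exact hC hf
    have hne : serClass M K e ≠ serClass M K f := by
      intro h
      exact hns (ser_of_mem_serClass hK heK (mem_serClass_self heK) (h ▸ mem_serClass_self hfK))
    apply Finset.one_lt_card.2
    refine ⟨serClass M K e, ?_, serClass M K f, ?_, hne⟩
    · rw [Finset.mem_filter]
      exact ⟨mem_serClasses.2 ⟨e, heK, rfl⟩, ⟨e, Finset.mem_inter.2 ⟨he, mem_serClass_self heK⟩⟩⟩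
    · rw [Finset.mem_filter]
      exact ⟨mem_serClasses.2 ⟨f, hfK, rfl⟩, ⟨f, Finset.mem_inter.2 ⟨hf, mem_serClass_self hfK⟩⟩⟩
  · intro h
    obtain ⟨N₁, hN₁, N₂, hN₂, hne⟩ := Finset.one_lt_card.1 h
    rw [Finset.mem_filter] at hN₁ hN₂
    obtain ⟨f, hf⟩ := hN₁.2
    obtain ⟨g, hg⟩ := hN₂.2
    rw [Finset.mem_inter] at hf hg
    refine ⟨f, hf.1, g, hg.1, ?_⟩
    apply not_ser_of_ne_serClass hK hcf (hC hf.1) (hC hg.1)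
    rw [← eq_serClass_of_mem hK hN₁.1 hf.2, ← eq_serClass_of_mem hK hN₂.1 hg.2]
    exact hne

/-- `drk K C ≤ 1` iff `C` meets at most one series class. -/
theorem drk_le_one_iff_hits_le_one {K C : Finset α} (hK : K ⊆ gr M) (hK2 : nrk M K + 2 = K.card)
    (hcf : cyclicPart M K = K) (hC : C ⊆ K) : drk M K C ≤ 1 ↔ hitsF M K C ≤ 1 := by
  have h1 := drk_eq_two_iff_two_le_hits hK hK2 hcf hC
  have h2 := drk_le_two hK2 hC
  constructor
  · intro h
    by_contra hcon
    have := h1.2 (by omega)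
    omega
  · intro h
    by_contra hcon
    have := h1.1 (by omega)
    omega

/-- A class meeting `C.erase e` meets `C`. -/
theorem filter_erase_subset {K C : Finset α} (e : α) :
    (serClasses M K).filter (fun N => ((C.erase e) ∩ N).Nonempty) ⊆
      (serClasses M K).filter (fun N => (C ∩ N).Nonempty) := by
  intro N hN
  rw [Finset.mem_filter] at hN ⊢
  refine ⟨hN.1, hN.2.mono ?_⟩
  exact Finset.inter_subset_inter_right (Finset.erase_subset e C)

/-- The class of `e ∈ C` is the only class that can stop meeting `C` when `e` is removed. -/
theorem filter_sdiff_filter_erase_subset {K C : Finset α} (hK : K ⊆ gr M) {e : α} :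
    (serClasses M K).filter (fun N => (C ∩ N).Nonempty) \
      (serClasses M K).filter (fun N => ((C.erase e) ∩ N).Nonempty) ⊆ {serClass M K e} := by
  intro N hN
  rw [Finset.mem_sdiff, Finset.mem_filter, Finset.mem_filter] at hN
  rw [Finset.mem_singleton]
  obtain ⟨⟨hN, hCN⟩, hnot⟩ := hN
  obtain ⟨f, hf⟩ := hCN
  rw [Finset.mem_inter] at hf
  by_contra hne
  apply hnot
  refine ⟨hN, ⟨f, ?_⟩⟩
  rw [Finset.mem_inter, Finset.mem_erase]
  refine ⟨⟨?_, hf.1⟩, hf.2⟩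
  rintro rfl
  exact hne (eq_serClass_of_mem hK hN hf.2)

/-- **Cyclic sets of dual rank two** are those meeting at least three classes, or exactly two classes in at least two
points each. -/
theorem isCyc_and_drk_two_iff {K C : Finset α} (hK : K ⊆ gr M) (hK2 : nrk M K + 2 = K.card)
    (hcf : cyclicPart M K = K) (hC : C ⊆ K) :
    (drk M K C = 2 ∧ IsCyc M K C) ↔
      (3 ≤ hitsF M K C ∨ (hitsF M K C = 2 ∧ ∀ N ∈ serClasses M K, C ∩ N = ∅ ∨ 2 ≤ (C ∩ N).card)) := by
  constructor
  · rintro ⟨hd, hcyc⟩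
    have h2 := (drk_eq_two_iff_two_le_hits hK hK2 hcf hC).1 hd
    by_cases h3 : 3 ≤ hitsF M K C
    · exact Or.inl h3
    right
    refine ⟨by omega, ?_⟩
    intro N hN
    by_contra hcon
    rw [not_or] at hcon
    obtain ⟨hne, hlt⟩ := hcon
    obtain ⟨e, he⟩ := Finset.nonempty_iff_ne_empty.2 hne
    rw [Finset.mem_inter] at he
    -- `C ∩ N = {e}`, so `C.erase e` meets at most one class
    have hsingle : C ∩ N = {e} := by
      apply Finset.eq_singleton_iff_unique_mem.2
      refine ⟨Finset.mem_inter.2 he, fun x hx => ?_⟩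
      by_contra hxe
      have : 2 ≤ (C ∩ N).card := Finset.one_lt_card.2 ⟨x, hx, e, Finset.mem_inter.2 he, hxe⟩
      omega
    have hNe : N = serClass M K e := eq_serClass_of_mem hK hN he.2
    have hcyce := hcyc e he.1
    rw [hd] at hcyce
    have hle : drk M K (C.erase e) ≤ 1 := by
      apply (drk_le_one_iff_hits_le_one hK hK2 hcf ((Finset.erase_subset e C).trans hC)).2
      unfold hitsF
      -- `N` does not meet `C.erase e`, and the classes meeting `C` are exactly two
      have hNnot : N ∉ (serClasses M K).filter (fun N' => ((C.erase e) ∩ N').Nonempty) := by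
        rw [Finset.mem_filter, not_and]
        intro _ hne'
        obtain ⟨x, hx⟩ := hne'
        rw [Finset.mem_inter, Finset.mem_erase] at hx
        have : x ∈ C ∩ N := Finset.mem_inter.2 ⟨hx.1.2, hx.2⟩
        rw [hsingle, Finset.mem_singleton] at this
        exact hx.1.1 this
      have hsub : (serClasses M K).filter (fun N' => ((C.erase e) ∩ N').Nonempty) ⊆
          ((serClasses M K).filter (fun N' => (C ∩ N').Nonempty)).erase N := by
        intro N' hN'
        rw [Finset.mem_erase]
        exact ⟨fun h => hNnot (h ▸ hN'), filter_erase_subset e hN'⟩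
      have hcard := Finset.card_le_card hsub
      rw [Finset.card_erase_of_mem (by rw [Finset.mem_filter]; exact ⟨hN, ⟨e, Finset.mem_inter.2 he⟩⟩)] at hcard
      unfold hitsF at h2 h3
      omega
    omega
  · intro h
    have h2 : 2 ≤ hitsF M K C := by
      rcases h with h | ⟨h, -⟩ <;> omega
    have hd := (drk_eq_two_iff_two_le_hits hK hK2 hcf hC).2 h2
    refine ⟨hd, ?_⟩
    intro e he
    rw [hd]
    apply (drk_eq_two_iff_two_le_hits hK hK2 hcf ((Finset.erase_subset e C).trans hC)).2
    unfold hitsF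
    -- removing `e` loses at most the class of `e`
    have hsdiff := filter_sdiff_filter_erase_subset (C := C) hK (e := e)
    have hcard := Finset.card_le_card hsdiff
    rw [Finset.card_singleton, Finset.card_sdiff_of_subset (filter_erase_subset e)] at hcard
    rcases h with h3 | ⟨h2', hmin⟩
    · unfold hitsF at h3
      omega
    · -- the class of `e` still meets `C.erase e`: it has at least two points of `C`
      have heK : e ∈ cyclicPart M K := by rw [hcf]; exact hC he
      have hNe : serClass M K e ∈ serClasses M K := mem_serClasses.2 ⟨e, heK, rfl⟩
      have hmin' := hmin _ hNe
      have hnonempty : (C ∩ serClass M K e).Nonempty := ⟨e, Finset.mem_inter.2 ⟨he, mem_serClass_self heK⟩⟩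
      have h2pts : 2 ≤ (C ∩ serClass M K e).card := by
        rcases hmin' with h | h
        · exact absurd h (Finset.nonempty_iff_ne_empty.1 hnonempty)
        · exact h
      have hstill : serClass M K e ∈ (serClasses M K).filter (fun N => ((C.erase e) ∩ N).Nonempty) := by
        rw [Finset.mem_filter]
        refine ⟨hNe, ?_⟩
        obtain ⟨x, hx, hxe⟩ : ∃ x ∈ C ∩ serClass M K e, x ≠ e := by
          by_contra hcon
          have : C ∩ serClass M K e = {e} := Finset.eq_singleton_iff_unique_mem.2
            ⟨Finset.mem_inter.2 ⟨he, mem_serClass_self heK⟩, fun x hx => by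
              by_contra hxe
              exact hcon ⟨x, hx, hxe⟩⟩
          rw [this, Finset.card_singleton] at h2pts
          omega
        rw [Finset.mem_inter] at hx
        exact ⟨x, Finset.mem_inter.2 ⟨Finset.mem_erase.2 ⟨hxe, hx.1⟩, hx.2⟩⟩
      -- so nothing is lost
      have hnone : (serClasses M K).filter (fun N => (C ∩ N).Nonempty) \
          (serClasses M K).filter (fun N => ((C.erase e) ∩ N).Nonempty) = ∅ := by
        apply Finset.eq_empty_of_forall_notMem
        intro N hN
        have := hsdiff hN
        rw [Finset.mem_singleton] at this
        subst this
        exact (Finset.mem_sdiff.1 hN).2 hstill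
      have hsub2 := Finset.card_le_card (Finset.sdiff_eq_empty_iff_subset.1 hnone)
      unfold hitsF at h2'
      omega

/-- An enumeration of the series classes of `K`: a duplicate-free list with `L.toFinset = serClasses K`. -/
def IsClassList (M : Matroid α) [M.Finite] (K : Finset α) (L : List (Finset α)) : Prop :=
  L.Nodup ∧ L.toFinset = serClasses M K

/-- Members of a class list are classes. -/
theorem mem_serClasses_of_mem_classList {K : Finset α} {L : List (Finset α)} (hL : IsClassList M K L) {N : Finset α}
    (hN : N ∈ L) : N ∈ serClasses M K := by
  rw [← hL.2, List.mem_toFinset]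
  exact hN

/-- A class list is pairwise disjoint. -/
theorem pairwise_disjoint_of_isClassList {K : Finset α} (hK : K ⊆ gr M) {L : List (Finset α)}
    (hL : IsClassList M K L) : L.Pairwise Disjoint := by
  apply hL.1.pairwise_of_forall_ne
  intro N hN N' hN' hne
  exact pairwiseDisjoint_serClasses hK (mem_serClasses_of_mem_classList hL hN)
    (mem_serClasses_of_mem_classList hL hN') hne

/-- `unionL L = L.toFinset.biUnion id`. -/
theorem unionL_eq_biUnion (L : List (Finset α)) : unionL L = L.toFinset.biUnion id := by
  induction L with
  | nil => simp [unionL_nil]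
  | cons N L ih => rw [unionL_cons, ih, List.toFinset_cons, Finset.biUnion_insert, id]

/-- The union of a class list of a coloop-free `K` is `K`. -/
theorem unionL_eq_of_isClassList {K : Finset α} (hcf : cyclicPart M K = K) {L : List (Finset α)}
    (hL : IsClassList M K L) : unionL L = K := by
  rw [unionL_eq_biUnion, hL.2, biUnion_serClasses, hcf]

/-- `hitsL L C = hitsF K C` for a class list. -/
theorem hitsL_eq_hitsF {K : Finset α} {L : List (Finset α)} (hL : IsClassList M K L) (C : Finset α) :
    hitsL L C = hitsF M K C := by
  unfold hitsL hitsF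
  rw [← List.toFinset_card_of_nodup (hL.1.filter _), List.toFinset_filter, hL.2]
  congr 1
  apply Finset.filter_congr
  intro N _
  simp

/-- `min2L L C = true` iff every class met by `C` is met in at least two points. -/
theorem min2L_eq_true_iff {K : Finset α} {L : List (Finset α)} (hL : IsClassList M K L) (C : Finset α) :
    min2L L C = true ↔ ∀ N ∈ serClasses M K, C ∩ N = ∅ ∨ 2 ≤ (C ∩ N).card := by
  unfold min2L
  rw [List.all_eq_true]
  constructor
  · intro h N hN
    have := h N (by rw [← List.mem_toFinset, hL.2]; exact hN)
    exact decide_eq_true_iff.1 this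
  · intro h N hN
    exact decide_eq_true_iff.2 (h N (mem_serClasses_of_mem_classList hL hN))

open scoped Classical in
/-- **The table's `cyc` is the cyclic count**: for a class list `L` of a coloop-free `K` of nullity two,
`cyc (L.map card) s = #{C ⊆ K : |C| = s, drk K C = 2, C cyclic}`. -/
theorem cyc_eq_card_filter {K : Finset α} (hK : K ⊆ gr M) (hK2 : nrk M K + 2 = K.card) (hcf : cyclicPart M K = K)
    {L : List (Finset α)} (hL : IsClassList M K L) (s : ℕ) :
    StarTable.cyc (L.map Finset.card) s =
      ((K.powersetCard s).filter (fun C => drk M K C = 2 ∧ IsCyc M K C)).card := by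
  unfold StarTable.cyc
  rw [cycRec_eq_card L (pairwise_disjoint_of_isClassList hK hL) s 0 true 1, one_mul,
    unionL_eq_of_isClassList hcf hL]
  congr 1
  apply Finset.filter_congr
  intro C hC
  rw [Finset.mem_powersetCard] at hC
  rw [isCyc_and_drk_two_iff hK hK2 hcf hC.1, hitsL_eq_hitsF hL, zero_add, Bool.true_and]
  unfold cycCond
  rw [min2L_eq_true_iff hL]

end SevenThree

end PercRepro
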